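import Summits.AtomisticToContinuum.Crystallization.Theorems.FreeSplittingCertificatesStrictSplittingRuleNearBoxInterp
import Mathlib.Algebra.Order.Floor.Semiring

/-!
# `StrictSplittingRule` (stmt-AtomisticToContinuum-12560), H12⋆ architecture, NEAR half: the GRID form of the box lemma

Companion of `…NearBoxInterp` (PART B gen 15, CERT §22 of HOME `run/shared/lean/b2b/freesplit-r2/`).  The near certificate is known at the
nodes of a uniform rectangular GRID `(a₀ + i·p, h₀ + j·q)`, `i ≤ n₁`, `j ≤ n₂` (25 exact `LDLᵀ` certificates for the 5×5 grid of the tree enclosure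
of the hcp-family minimiser), and the second derivatives of `F(a,h) = zᵀA(a,h)z` are bounded on the whole box (range automatic differentiation).
`grid_lower_of_deriv2_le` packages the cell-location step (`exists_cell_index`: every point of `[x₀, x₀ + n·p]` lies in some cell
`[x₀ + i·p, x₀ + (i+1)·p]`, `i < n`) with `box_lower_of_deriv2_le` applied to that cell: **`F ≥ m − (B₁p² + B₂q²)/8` on the whole box** — the
remainder scales with the CELL size, not the box size.  Value = certificate glue; NOT a proof of H12⋆, NOT summit progress.
-/

noncomputable section

namespace Summit.AtomisticToContinuum.Crystallization.Theorems.StrictSplittingRuleBirth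

open Set

/-- **Cell location on a uniform 1-D grid.**  For `p > 0`, `1 ≤ n` and `x ∈ [x₀, x₀ + n·p]` there is a cell index `i < n` with
`x₀ + i·p ≤ x ≤ x₀ + (i+1)·p`. -/
theorem exists_cell_index {x₀ p x : ℝ} {n : ℕ} (hp : 0 < p) (hn : 1 ≤ n) (hx : x ∈ Icc x₀ (x₀ + n * p)) :
    ∃ i : ℕ, i < n ∧ x₀ + i * p ≤ x ∧ x ≤ x₀ + (i + 1) * p := by
  obtain ⟨hx0, hx1⟩ := hx
  set t : ℝ := (x - x₀) / p with ht
  have ht0 : 0 ≤ t := div_nonneg (by linarith) hp.le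
  have htn : t ≤ n := by
    rw [ht, div_le_iff₀ hp]; linarith
  have hxt : x = x₀ + t * p := by rw [ht]; field_simp; ring
  by_cases hlt : t < n
  · refine ⟨⌊t⌋₊, ?_, ?_, ?_⟩
    · exact (Nat.floor_lt ht0).mpr hlt
    · have h1 : (⌊t⌋₊ : ℝ) ≤ t := Nat.floor_le ht0
      rw [hxt]; nlinarith
    · have h2 : t < (⌊t⌋₊ : ℝ) + 1 := Nat.lt_floor_add_one t
      rw [hxt]; nlinarith
  · have hte : t = n := le_antisymm htn (not_lt.mp hlt)
    refine ⟨n - 1, Nat.sub_lt hn Nat.one_pos, ?_, ?_⟩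
    · have hcast : ((n - 1 : ℕ) : ℝ) = (n : ℝ) - 1 := by
        rw [Nat.cast_sub hn, Nat.cast_one]
      rw [hxt, hte, hcast]; nlinarith
    · have hcast : ((n - 1 : ℕ) : ℝ) + 1 = (n : ℝ) := by
        rw [Nat.cast_sub hn, Nat.cast_one]; ring
      rw [hxt, hte, hcast]

/-- **The grid lemma.**  `F : ℝ → ℝ → ℝ` on the box `[a₀, a₀ + n₁p] × [h₀, h₀ + n₂q]` (`p, q > 0`, `n₁, n₂ ≥ 1`): if `F ≥ m` at every grid node
`(a₀ + i·p, h₀ + j·q)` (`i ≤ n₁`, `j ≤ n₂`), `F` has `a`-derivatives up to order two with `∂²F/∂a² ≤ B₁` and `h`-derivatives up to order two with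
`∂²F/∂h² ≤ B₂` at every point of the box, then `F ≥ m − (B₁p² + B₂q²)/8` on the whole box. -/
theorem grid_lower_of_deriv2_le {F Fa Faa Fh Fhh : ℝ → ℝ → ℝ} {a₀ h₀ p q B₁ B₂ m : ℝ} {n₁ n₂ : ℕ}
    (hp : 0 < p) (hq : 0 < q) (hn₁ : 1 ≤ n₁) (hn₂ : 1 ≤ n₂) (hB₁ : 0 ≤ B₁) (hB₂ : 0 ≤ B₂)
    (nodes : ∀ i j : ℕ, i ≤ n₁ → j ≤ n₂ → m ≤ F (a₀ + i * p) (h₀ + j * q))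
    (dFa : ∀ a ∈ Icc a₀ (a₀ + n₁ * p), ∀ h ∈ Icc h₀ (h₀ + n₂ * q), HasDerivAt (fun a => F a h) (Fa a h) a)
    (dFaa : ∀ a ∈ Icc a₀ (a₀ + n₁ * p), ∀ h ∈ Icc h₀ (h₀ + n₂ * q), HasDerivAt (fun a => Fa a h) (Faa a h) a)
    (bFaa : ∀ a ∈ Icc a₀ (a₀ + n₁ * p), ∀ h ∈ Icc h₀ (h₀ + n₂ * q), Faa a h ≤ B₁)
    (dFh : ∀ a ∈ Icc a₀ (a₀ + n₁ * p), ∀ h ∈ Icc h₀ (h₀ + n₂ * q), HasDerivAt (fun h => F a h) (Fh a h) h)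
    (dFhh : ∀ a ∈ Icc a₀ (a₀ + n₁ * p), ∀ h ∈ Icc h₀ (h₀ + n₂ * q), HasDerivAt (fun h => Fh a h) (Fhh a h) h)
    (bFhh : ∀ a ∈ Icc a₀ (a₀ + n₁ * p), ∀ h ∈ Icc h₀ (h₀ + n₂ * q), Fhh a h ≤ B₂)
    {a h : ℝ} (ha : a ∈ Icc a₀ (a₀ + n₁ * p)) (hh : h ∈ Icc h₀ (h₀ + n₂ * q)) :
    m - (B₁ * p ^ 2 + B₂ * q ^ 2) / 8 ≤ F a h := by
  obtain ⟨i, hi, hia, hai⟩ := exists_cell_index hp hn₁ ha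
  obtain ⟨j, hj, hjh, hhj⟩ := exists_cell_index hq hn₂ hh
  -- the cell [aL, aR] × [hL, hR]
  set aL := a₀ + i * p with haL
  set aR := a₀ + (i + 1) * p with haR
  set hL := h₀ + j * q with hhL
  set hR := h₀ + (j + 1) * q with hhR
  have haLR : aL < aR := by rw [haL, haR]; nlinarith
  have hhLR : hL < hR := by rw [hhL, hhR]; nlinarith
  have hi1 : (i : ℝ) + 1 ≤ n₁ := by exact_mod_cast hi
  have hj1 : (j : ℝ) + 1 ≤ n₂ := by exact_mod_cast hj
  have hi0 : (0 : ℝ) ≤ i := Nat.cast_nonneg i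
  have hj0 : (0 : ℝ) ≤ j := Nat.cast_nonneg j
  -- the cell lies inside the box
  have cellA : ∀ x ∈ Icc aL aR, x ∈ Icc a₀ (a₀ + n₁ * p) := by
    intro x hx; obtain ⟨h1, h2⟩ := hx
    constructor
    · have : a₀ ≤ aL := by rw [haL]; nlinarith
      linarith
    · have : aR ≤ a₀ + n₁ * p := by rw [haR]; nlinarith
      linarith
  have cellH : ∀ y ∈ Icc hL hR, y ∈ Icc h₀ (h₀ + n₂ * q) := by
    intro y hy; obtain ⟨h1, h2⟩ := hy
    constructor
    · have : h₀ ≤ hL := by rw [hhL]; nlinarith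
      linarith
    · have : hR ≤ h₀ + n₂ * q := by rw [hhR]; nlinarith
      linarith
  -- corner facts: the cell corners are grid nodes
  have eR : ((i + 1 : ℕ) : ℝ) = (i : ℝ) + 1 := by push_cast; ring
  have eRh : ((j + 1 : ℕ) : ℝ) = (j : ℝ) + 1 := by push_cast; ring
  have c00 : m ≤ F aL hL := nodes i j hi.le hj.le
  have c01 : m ≤ F aL hR := by
    have := nodes i (j + 1) hi.le hj; rwa [eRh] at this
  have c10 : m ≤ F aR hL := by
    have := nodes (i + 1) j hi hj.le; rwa [eR] at this
  have c11 : m ≤ F aR hR := by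
    have := nodes (i + 1) (j + 1) hi hj; rwa [eR, eRh] at this
  have key := box_lower_of_deriv2_le (F := F) (Fa := Fa) (Faa := Faa) (Fh := Fh) (Fhh := Fhh) (m := m) haLR hhLR hB₁ hB₂
    (fun h' hh' a' ha' => dFa a' (cellA a' ha') h' (cellH h' hh'))
    (fun h' hh' a' ha' => dFaa a' (cellA a' ha') h' (cellH h' hh'))
    (fun h' hh' a' ha' => bFaa a' (cellA a' ha') h' (cellH h' hh'))
    (fun a' ha' h' hh' => dFh a' (by
        rcases ha' with rfl | rfl
        · exact cellA aL (left_mem_Icc.mpr haLR.le)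
        · exact cellA aR (right_mem_Icc.mpr haLR.le)) h' (cellH h' hh'))
    (fun a' ha' h' hh' => dFhh a' (by
        rcases ha' with rfl | rfl
        · exact cellA aL (left_mem_Icc.mpr haLR.le)
        · exact cellA aR (right_mem_Icc.mpr haLR.le)) h' (cellH h' hh'))
    (fun a' ha' h' hh' => bFhh a' (by
        rcases ha' with rfl | rfl
        · exact cellA aL (left_mem_Icc.mpr haLR.le)
        · exact cellA aR (right_mem_Icc.mpr haLR.le)) h' (cellH h' hh'))
    c00 c01 c10 c11 ⟨hia, hai⟩ ⟨hjh, hhj⟩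
  have hsz : B₁ * (aR - aL) ^ 2 + B₂ * (hR - hL) ^ 2 = B₁ * p ^ 2 + B₂ * q ^ 2 := by
    rw [haL, haR, hhL, hhR]; ring
  rw [hsz] at key
  exact key

end Summit.AtomisticToContinuum.Crystallization.Theorems.StrictSplittingRuleBirth
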